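import Literature.Geometry.Manifold.DeRhamFundamentalClassPairing
import Literature.Geometry.Kaehler.ManifoldFormsFunSmulProofs
import HarnessLib

/-!
# A non-negative, somewhere positive multiple of a nowhere-vanishing top form is not exact

Topic `Literature/Geometry/Manifold`.  The global (Stokes) step of McLean's sign argument for the
wrapping number (M. McLean, GAFA 22 (2012), Lemma 5.17; fact seat of
`Literature.Geometry.Symplectic.mclean_divisorComplement_convex_four`): on a compact boundaryless
manifold `M` of dimension `n`, if `t` is a smooth nowhere-vanishing `n`-form (e.g. the symplectic
volume `ω ∧ ω` of a symplectic `4`-manifold) and `F ≥ 0` is a smooth function, positive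
somewhere, then `F · t` is **not** exact (`MForm.not_mem_exactSmoothForms_smul_of_forall_ne_zero`).
Indeed `t` orients `M` by its own ray (as in the tree's
`MForm.not_mem_exactSmoothForms_of_forall_ne_zero`, whose proof we follow line by line), for that
orientation `∫_M F t > 0` (`MForm.integral_pos_of_sign_mul_apply_nonneg`), while exact forms
integrate to zero (Stokes, `MForm.integral_eq_zero_of_mem_exactSmoothForms_holds`).  In McLean's
proof this is applied to `d(χ θ' ∧ ω) = (χ'(r²)(κ + r²/2) + χ) ω ∧ ω`, which would be such a
multiple if `κ ≥ 0`.

Everything is proved; no definitions, no named facts (D-0026).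

## References

* M. McLean, *The growth rate of symplectic homology and affine varieties*, GAFA 22 (2012),
  Lemma 5.17. [Mclean2012]
* J. M. Lee, *Introduction to Smooth Manifolds*, 2nd ed. (2013), Prop. 15.5, Prop. 16.6,
  Cor. 16.13. [LeeSmoothManifolds2013]
-/

noncomputable section

open scoped Manifold ContDiff Topology EuclideanSpace
open Set Function Module Filter
open Literature.Geometry.Kaehler Literature.NumberTheory.Transcendental

namespace Literature.Geometry.Manifold

variable {n : ℕ} {M : Type*} [TopologicalSpace M] [ChartedSpace (EuclideanSpace ℝ (Fin n)) M]
  [IsManifold (𝓡 n) ∞ M]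

/-- **A non-negative, somewhere positive smooth multiple of a nowhere-vanishing smooth top form on
a compact manifold is not exact** (Lee (2013), Prop. 15.5, 16.6(c), Cor. 16.13; the global step
of McLean (2012), Lemma 5.17). [cite: LeeSmoothManifolds2013, Prop. 16.6] -/
theorem _root_.Literature.Geometry.Kaehler.MForm.not_mem_exactSmoothForms_smul_of_forall_ne_zero
    [T2Space M] [CompactSpace M]
    {t : MForm (𝓡 n) M ℝ n} (ht : IsSmoothForm t) (hne : ∀ x, t x ≠ 0)
    {F : M → ℝ} (hF : ContMDiff (𝓡 n) 𝓘(ℝ, ℝ) ∞ F) (hF0 : ∀ x, 0 ≤ F x) (hF1 : ∃ x, 0 < F x) :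
    F • t ∉ exactSmoothForms (𝓡 n) M ℝ n := by
  set e : Module.Basis (Fin n) ℝ (EuclideanSpace ℝ (Fin n)) :=
    modelBasis (EuclideanSpace ℝ (Fin n)) n
  -- the form is non-zero on the reference frame and as an alternating map
  have hc : ∀ x, t x ⇑e ≠ 0 := fun x h ↦ hne x <| by
    have h2 : (t x).toAlternatingMap = 0 :=
      (AlternatingMap.map_basis_eq_zero_iff e (t x).toAlternatingMap).1 h
    exact ContinuousAlternatingMap.toAlternatingMap_injective
      (h2.trans ContinuousAlternatingMap.toAlternatingMap_zero.symm)
  have h0 : ∀ x, (t x).toAlternatingMap ≠ 0 := fun x h ↦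
    hne x (ContinuousAlternatingMap.toAlternatingMap_injective
      (h.trans ContinuousAlternatingMap.toAlternatingMap_zero.symm))
  -- the orientation family of the form `t`
  set o : (x : M) → _root_.Orientation ℝ (TangentSpace (𝓡 n) x) (Fin n) :=
    fun x ↦ rayOfNeZero ℝ _ (h0 x) with ho_def
  have hsign : ∀ (x₀ : M) (y : EuclideanSpace ℝ (Fin n)),
      chartSign o x₀ y = Real.sign (t.inChart x₀ y ⇑e) := by
    intro x₀ y
    simp only [ho_def, chartSign]
    rw [sign_someVector_rayOfNeZero]
    rfl
  have hsign' : ∀ x : M,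
      Real.sign (orientationForm o x ⇑e) = Real.sign (t x ⇑e) := fun x ↦
    sign_someVector_rayOfNeZero (t x).toAlternatingMap (h0 x) ⇑e
  -- continuity of the orientation family
  have ho : IsContinuousOrientation o := by
    intro x₀
    have hg : ContinuousWithinAt (fun y ↦ t.inChart x₀ y ⇑e) (range (𝓡 n))
        (extChartAt (𝓡 n) x₀ x₀) :=
      (continuous_eval_const (⇑e : Fin n → EuclideanSpace ℝ (Fin n))).continuousAt
        |>.comp_continuousWithinAt (ht x₀).continuousWithinAt
    have hg0 : t.inChart x₀ (extChartAt (𝓡 n) x₀ x₀) ⇑e ≠ 0 := by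
      rw [MForm.inChart_apply_self]
      exact hc x₀
    have hev : ∀ᶠ y in 𝓝[range (𝓡 n)] (extChartAt (𝓡 n) x₀ x₀),
        0 < t.inChart x₀ y ⇑(modelBasis (EuclideanSpace ℝ (Fin n)) n) *
          t.inChart x₀ (extChartAt (𝓡 n) x₀ x₀) ⇑(modelBasis (EuclideanSpace ℝ (Fin n)) n) :=
      (hg.tendsto.mul_const _).eventually (lt_mem_nhds (mul_self_pos.2 hg0))
    filter_upwards [hev] with y hy
    rw [hsign, hsign]
    rcases pos_and_pos_or_neg_and_neg_of_mul_pos hy with ⟨ha, hb⟩ | ⟨ha, hb⟩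
    · rw [Real.sign_of_pos ha, Real.sign_of_pos hb]
      exact ⟨rfl, one_ne_zero⟩
    · rw [Real.sign_of_neg ha, Real.sign_of_neg hb]
      exact ⟨rfl, neg_ne_zero.2 one_ne_zero⟩
  -- positivity of the integral of `F t`, and Stokes
  have hα : IsSmoothForm (F • t) := ht.fun_smul' hF
  have happ : ∀ x, (F • t) x ⇑e = F x * t x ⇑e := fun x ↦ rfl
  have hpos : 0 < (F • t).integral o := by
    refine MForm.integral_pos_of_sign_mul_apply_nonneg ho hα (fun x ↦ ?_) ?_
    · have h := abs_nonneg (t x ⇑(modelBasis (EuclideanSpace ℝ (Fin n)) n))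
      rw [← real_sign_mul_self, ← hsign' x] at h
      have h' := mul_nonneg (hF0 x) h
      calc (0 : ℝ) ≤ F x * (Real.sign (orientationForm o x ⇑e) * t x ⇑e) := h'
        _ = Real.sign (orientationForm o x ⇑e) * (F • t) x ⇑e := by rw [happ]; ring
    · obtain ⟨x, hx⟩ := hF1
      refine ⟨x, ?_⟩
      have h := abs_pos.2 (hc x)
      rw [← real_sign_mul_self, ← hsign' x] at h
      have h' := mul_pos hx h
      calc (0 : ℝ) < F x * (Real.sign (orientationForm o x ⇑e) * t x ⇑e) := h'
        _ = Real.sign (orientationForm o x ⇑e) * (F • t) x ⇑e := by rw [happ]; ring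
  intro hex
  exact hpos.ne' (MForm.integral_eq_zero_of_mem_exactSmoothForms_holds o ho hex)

end Literature.Geometry.Manifold
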